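import Mathlib
import HarnessLib.Audit
import Summits.PneNP.PneNP.Theorems.PstarUnionAtoms

/-!
# Case B of the union lemma: who reads the chords, the sheet of a read chord, alignment of a pinned reader (ROUND-24, memo §14.21; B6, B7, B8)

FRONTIER range-avoidance ladder, rung F-N3, ROUND 24 (cell `pnp-ideate`, planner memo `r24/CORE-BOUND-NOTES.md` §14.21, typed sketch `r24/SketchCaseB.lean` of planner p3 g22 —
statements B6, B7, B8 VERBATIM up to spelling out the sketch's abbreviations `GateFree`/`Reads`/`setPair` (no new definitions); restricted-model proof complexity — nothing here bears on `P` versus `NP`).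

Case B = the shared constraint `w₂` reads a private of some chord (linearly; hun keeps monomials off the privates).

* `read_by_someone` — **B6**: in a union-terminal configuration every chord private pair is touched by `A₀`, `A₁` or `w₂` (else A3 + cover contradict T3);
* `exists_Z_of_sheet` — **B7**: if `w₂` reads a literal of the chord `c` and `x` solves `J₀ − c` with `c` solvable by the product-zero setting `(0,0)` of its privates
  (the SHEET of `c`), then one of the three product-zero settings puts `x` into `Z = Sol(J₀) ∩ {w₂ = t₂}` (the value of `w₂` moves by `[a_c ∈ C₂]·a + [b_c ∈ C₂]·b`);
* `aligned_of_pinned` — **B8**: a reader pinned on `Z`, gate-free on the privates of two chords `c ≠ c'` both read by `w₂`, at a point of `Z` on both sheets, reads each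
  of `c, c'` either not at all or exactly as `w₂` does, uniformly (the nine product-zero settings of the two pairs; those with `w₂`-parity `0` lie in `Z`).

Tools: `setPair_two`, `setPair_of_ne`, `eval_setPair_of_ne`, `eval_setPair_self`, `bit_gval_setPair` (the three-point calculus of a private pair, as in A2
`PstarUnionAtoms.hard_of_pinned_read`).
-/

set_option linter.dupNamespace false -- `Summit.PneNP.PneNP.…`: summit = sub-problem name (D-0017 single-conjunct layout)

open Finset Literature.Computability.Complexity
open Summit.PneNP.PneNP.Theorems.PstarFibrePolys (bit bit_injective)
open Summit.PneNP.PneNP.Theorems.PstarTyped (Typed)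
open Summit.PneNP.PneNP.Theorems.PstarSALevel (varSet bdry BoundaryExpanding SimpleOverlap)
open Summit.PneNP.PneNP.Theorems.PstarGapPeeling (not_mem_varSet_of_private eval_update_of_not_mem eval_pure)
open Summit.PneNP.PneNP.Theorems.PstarCentreFree (vars_mem_varSet)
open Summit.PneNP.PneNP.Theorems.PstarGapOneAll (gval)
open Summit.PneNP.PneNP.Theorems.PstarCoreBound (XorClosed)
open Summit.PneNP.PneNP.Theorems.PstarChordRepair (IsChord)
open Summit.PneNP.PneNP.Theorems.PstarChordBridgeCotree (Peelable)
open Summit.PneNP.PneNP.Theorems.PstarChordBridgeTools (privs mem_privs)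
open Summit.PneNP.PneNP.Theorems.PstarUnion (SatPair UnionTerminal UnionFive)
open Summit.PneNP.PneNP.Theorems.PstarUnionAtoms (Untouched satPair_of_erase_chord)
open Summit.PneNP.PneNP.Theorems.PstarFreshErase (bit_gval_update_lin)

namespace Summit.PneNP.PneNP.Theorems.PstarUnionCaseB

variable {n m : ℕ}

/-! ## B6 — every chord is read by someone -/

/-- **B6.**  If nobody touches the privates of the chord `c`, cover + A3 contradict T3. -/
theorem read_by_someone (I : LocalMap 4 n m) (hI : I.IsPure xorAndPred) {y : Fin m → Bool} {J₀ : Finset (Fin m)}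
    {A₀ A₁ w₂ : Finset (Fin n) × Finset (Fin m) × Bool} (hT₀ : ¬ SatPair I y J₀ A₀ w₂) (hT₁ : ¬ SatPair I y J₀ A₁ w₂)
    (hcov : ∀ f ∈ J₀, SatPair I y (J₀.erase f) A₀ w₂ ∨ SatPair I y (J₀.erase f) A₁ w₂) {c : Fin m} (hc : c ∈ J₀) (hch : IsChord I J₀ c)
    (hw : Untouched I w₂ (I.vars c 2) ∧ Untouched I w₂ (I.vars c 3)) (h₀ : Untouched I A₀ (I.vars c 2) ∧ Untouched I A₀ (I.vars c 3))
    (h₁ : Untouched I A₁ (I.vars c 2) ∧ Untouched I A₁ (I.vars c 3)) : False := by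
  rcases hcov c hc with h | h
  · exact hT₀ (satPair_of_erase_chord I hI hc hch A₀ w₂ h₀ hw h)
  · exact hT₁ (satPair_of_erase_chord I hI hc hch A₁ w₂ h₁ hw h)

/-! ## The three-point calculus of a private pair -/

/-- The values at the pair. -/
theorem setPair_two (I : LocalMap 4 n m) (hI : I.IsPure xorAndPred) (c : Fin m) (x : Fin n → Bool) (a b : Bool) :
    Function.update (Function.update x (I.vars c 2) a) (I.vars c 3) b (I.vars c 2) = a ∧ Function.update (Function.update x (I.vars c 2) a) (I.vars c 3) b (I.vars c 3) = b := by
  have h23 : I.vars c 2 ≠ I.vars c 3 := fun h => absurd (hI.2 c h) (by decide)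
  rw [Function.update_of_ne h23, Function.update_self, Function.update_self]
  exact ⟨rfl, rfl⟩

/-- Off the pair nothing changes. -/
theorem setPair_of_ne (I : LocalMap 4 n m) (c : Fin m) (x : Fin n → Bool) (a b : Bool) {v : Fin n} (h2 : v ≠ I.vars c 2) (h3 : v ≠ I.vars c 3) :
    Function.update (Function.update x (I.vars c 2) a) (I.vars c 3) b v = x v := by
  rw [Function.update_of_ne h3, Function.update_of_ne h2]

/-- Other outputs of the core do not see the private pair of a chord. -/
theorem eval_setPair_of_ne (I : LocalMap 4 n m) {J₀ : Finset (Fin m)} {c : Fin m} (hc : c ∈ J₀) (hch : IsChord I J₀ c) (x : Fin n → Bool)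
    (a b : Bool) {j : Fin m} (hj : j ∈ J₀) (hjc : j ≠ c) : I.eval (Function.update (Function.update x (I.vars c 2) a) (I.vars c 3) b) j = I.eval x j := by
  rw [eval_update_of_not_mem I j _ (not_mem_varSet_of_private I hc hj hjc hch.2 (vars_mem_varSet I c 3)),
    eval_update_of_not_mem I j _ (not_mem_varSet_of_private I hc hj hjc hch.1 (vars_mem_varSet I c 2))]

/-- The chord itself sees only the product of the pair. -/
theorem eval_setPair_self (I : LocalMap 4 n m) (hI : I.IsPure xorAndPred) (c : Fin m) (x : Fin n → Bool) {a b a' b' : Bool}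
    (h : (a && b) = (a' && b')) : I.eval (Function.update (Function.update x (I.vars c 2) a) (I.vars c 3) b) c = I.eval (Function.update (Function.update x (I.vars c 2) a') (I.vars c 3) b') c := by
  have hinj := hI.2 c
  have h02 : I.vars c 0 ≠ I.vars c 2 := fun h => absurd (hinj h) (by decide)
  have h03 : I.vars c 0 ≠ I.vars c 3 := fun h => absurd (hinj h) (by decide)
  have h12 : I.vars c 1 ≠ I.vars c 2 := fun h => absurd (hinj h) (by decide)
  have h13 : I.vars c 1 ≠ I.vars c 3 := fun h => absurd (hinj h) (by decide)
  rw [eval_pure I hI, eval_pure I hI, (setPair_two I hI c x a b).1, (setPair_two I hI c x a b).2, (setPair_two I hI c x a' b').1,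
    (setPair_two I hI c x a' b').2, setPair_of_ne I c x a b h02 h03, setPair_of_ne I c x a b h12 h13, setPair_of_ne I c x a' b' h02 h03,
    setPair_of_ne I c x a' b' h12 h13, h]

/-- **A gate-free constraint moves linearly on the three-point set**: `A(setPair a b) = A(x) + [a_c ∈ C]·(a + x_{a_c}) + [b_c ∈ C]·(b + x_{b_c})`. -/
theorem bit_gval_setPair (I : LocalMap 4 n m) (hI : I.IsPure xorAndPred) {c : Fin m} {A : Finset (Fin n) × Finset (Fin m) × Bool}
    (hg : ∀ g ∈ A.2.1, I.vars g 2 ≠ I.vars c 2 ∧ I.vars g 3 ≠ I.vars c 2 ∧ I.vars g 2 ≠ I.vars c 3 ∧ I.vars g 3 ≠ I.vars c 3)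
    (x : Fin n → Bool) (a b : Bool) :
    bit (gval I A.1 A.2.1 (Function.update (Function.update x (I.vars c 2) a) (I.vars c 3) b)) = bit (gval I A.1 A.2.1 x)
      + (if I.vars c 2 ∈ A.1 then bit a + bit (x (I.vars c 2)) else 0) + (if I.vars c 3 ∈ A.1 then bit b + bit (x (I.vars c 3)) else 0) := by
  have h23 : I.vars c 2 ≠ I.vars c 3 := fun h => absurd (hI.2 c h) (by decide)
  rw [bit_gval_update_lin I A.1 _ (fun g hg' => ⟨(hg g hg').2.2.1, (hg g hg').2.2.2⟩),
    bit_gval_update_lin I A.1 _ (fun g hg' => ⟨(hg g hg').1, (hg g hg').2.1⟩), Function.update_of_ne h23.symm]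

/-! ## B7 — the sheet of a chord read by `w₂` reaches `Z` -/

/-- **B7.**  `w₂` reads a literal of `c` (no monomial on its privates), `x` solves `J₀ − c`, and `c` is solvable at `x` by the product-zero setting `(0,0)`.
Then some product-zero setting of the private pair solves `J₀` AND gives `w₂ = t₂`. -/
theorem exists_Z_of_sheet (I : LocalMap 4 n m) (hI : I.IsPure xorAndPred) {y : Fin m → Bool} {J₀ : Finset (Fin m)} {c : Fin m}
    (hc : c ∈ J₀) (hch : IsChord I J₀ c) (w₂ : Finset (Fin n) × Finset (Fin m) × Bool)
    (hg : ∀ g ∈ w₂.2.1, I.vars g 2 ≠ I.vars c 2 ∧ I.vars g 3 ≠ I.vars c 2 ∧ I.vars g 2 ≠ I.vars c 3 ∧ I.vars g 3 ≠ I.vars c 3)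
    (hread : I.vars c 2 ∈ w₂.1 ∨ I.vars c 3 ∈ w₂.1)
    {x : Fin n → Bool} (hx : ∀ j ∈ J₀, j ≠ c → I.eval x j = y j) (h0 : I.eval (Function.update (Function.update x (I.vars c 2) false) (I.vars c 3) false) c = y c) :
    ∃ a b : Bool, (a && b) = false ∧ (∀ j ∈ J₀, I.eval (Function.update (Function.update x (I.vars c 2) a) (I.vars c 3) b) j = y j) ∧ gval I w₂.1 w₂.2.1 (Function.update (Function.update x (I.vars c 2) a) (I.vars c 3) b) = w₂.2.2 := by
  -- the three product-zero settings all solve `J₀`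
  have hsol : ∀ a b : Bool, (a && b) = false → ∀ j ∈ J₀, I.eval (Function.update (Function.update x (I.vars c 2) a) (I.vars c 3) b) j = y j := by
    intro a b hab j hj
    by_cases hjc : j = c
    · subst hjc
      rw [eval_setPair_self I hI j x (a' := false) (b' := false) (by rw [hab]; rfl)]
      exact h0
    · rw [eval_setPair_of_ne I hc hch x a b hj hjc]
      exact hx j hj hjc
  -- the value of `w₂` on them
  have hval := bit_gval_setPair I hI hg x
  by_cases h00 : gval I w₂.1 w₂.2.1 (Function.update (Function.update x (I.vars c 2) false) (I.vars c 3) false) = w₂.2.2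
  · exact ⟨false, false, rfl, hsol false false rfl, h00⟩
  · -- `w₂ ≠ t₂` at `(0,0)`: flip the literal it reads
    have e : ∀ s t : Bool, s ≠ t → bit s = bit t + 1 := by decide
    have hb00 := e _ _ h00
    rcases hread with h2 | h3
    · refine ⟨true, false, rfl, hsol true false rfl, ?_⟩
      apply bit_injective
      have h1 := hval true false
      have h0 := hval false false
      rw [if_pos h2] at h1 h0
      rw [h1]
      rw [h0] at hb00
      revert hb00
      generalize bit (gval I w₂.1 w₂.2.1 x) = g; generalize bit w₂.2.2 = t; generalize bit (x (I.vars c 2)) = p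
      generalize (if I.vars c 3 ∈ w₂.1 then bit false + bit (x (I.vars c 3)) else 0) = q
      revert g t p q; decide
    · refine ⟨false, true, rfl, hsol false true rfl, ?_⟩
      apply bit_injective
      have h1 := hval false true
      have h0 := hval false false
      rw [if_pos h3] at h1 h0
      rw [h1]
      rw [h0] at hb00
      revert hb00
      generalize bit (gval I w₂.1 w₂.2.1 x) = g; generalize bit w₂.2.2 = t; generalize bit (x (I.vars c 3)) = p
      generalize (if I.vars c 2 ∈ w₂.1 then bit false + bit (x (I.vars c 2)) else 0) = q
      revert g t p q; decide

/-! ## B8 — alignment of a pinned reader with `w₂` on two jointly free chords -/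

/-- The `𝔽₂` core of B8: on the three product-zero states of a pair (seen from a product-zero base state), a linear functional `(p, q)` that vanishes where
`(α, β)` vanishes and equals `ε` where `(α, β)` equals `1` is `ε·(α, β)` (the two non-zero moves span `𝔽₂²`). -/
private theorem align_core : ∀ (xa xb : Bool), (xa && xb) = false → ∀ (α β p q ε : ZMod 2),
    (∀ s₁ s₂ : Bool, (s₁ && s₂) = false →
      (α * (bit s₁ + bit xa) + β * (bit s₂ + bit xb) = 0 → p * (bit s₁ + bit xa) + q * (bit s₂ + bit xb) = 0) ∧
      (α * (bit s₁ + bit xa) + β * (bit s₂ + bit xb) = 1 → p * (bit s₁ + bit xa) + q * (bit s₂ + bit xb) = ε)) →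
    p = ε * α ∧ q = ε * β := by
  decide

/-- A non-zero functional takes the value `1` on some product-zero move. -/
private theorem exists_move : ∀ (xa xb : Bool), (xa && xb) = false → ∀ (α β : ZMod 2), (α ≠ 0 ∨ β ≠ 0) →
    ∃ s₁ s₂ : Bool, (s₁ && s₂) = false ∧ α * (bit s₁ + bit xa) + β * (bit s₂ + bit xb) = 1 := by
  decide

/-- `[P]·t` for the indicator-weighted terms. -/
private theorem ite_eq_ind_mul (P : Prop) [Decidable P] (t : ZMod 2) : (if P then t else 0) = (if P then (1 : ZMod 2) else 0) * t := by
  split_ifs <;> simp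

/-- **B8.**  `w₂` reads literals of the distinct chords `c, c'` (no monomials on their privates), the reader `φ` touches those privates at most linearly and is
constant on `Z = Sol(J₀) ∩ {w₂ = t₂}`, and `x ∈ Z` lies on both sheets (both private products are `0`).  Then `φ` reads each of `c, c'` either not at all or
through exactly the same literal set as `w₂`, and it reads `c` iff it reads `c'`. -/
theorem aligned_of_pinned (I : LocalMap 4 n m) (hI : I.IsPure xorAndPred) {y : Fin m → Bool} {J₀ : Finset (Fin m)} {c c' : Fin m}
    (hc : c ∈ J₀) (hc' : c' ∈ J₀) (hch : IsChord I J₀ c) (hch' : IsChord I J₀ c') (hne : c ≠ c')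
    (w₂ φ : Finset (Fin n) × Finset (Fin m) × Bool)
    (hg : (∀ g ∈ w₂.2.1, I.vars g 2 ≠ I.vars c 2 ∧ I.vars g 3 ≠ I.vars c 2 ∧ I.vars g 2 ≠ I.vars c 3 ∧ I.vars g 3 ≠ I.vars c 3) ∧
      (∀ g ∈ w₂.2.1, I.vars g 2 ≠ I.vars c' 2 ∧ I.vars g 3 ≠ I.vars c' 2 ∧ I.vars g 2 ≠ I.vars c' 3 ∧ I.vars g 3 ≠ I.vars c' 3))
    (hφ : (∀ g ∈ φ.2.1, I.vars g 2 ≠ I.vars c 2 ∧ I.vars g 3 ≠ I.vars c 2 ∧ I.vars g 2 ≠ I.vars c 3 ∧ I.vars g 3 ≠ I.vars c 3) ∧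
      (∀ g ∈ φ.2.1, I.vars g 2 ≠ I.vars c' 2 ∧ I.vars g 3 ≠ I.vars c' 2 ∧ I.vars g 2 ≠ I.vars c' 3 ∧ I.vars g 3 ≠ I.vars c' 3))
    (hw : (I.vars c 2 ∈ w₂.1 ∨ I.vars c 3 ∈ w₂.1) ∧ (I.vars c' 2 ∈ w₂.1 ∨ I.vars c' 3 ∈ w₂.1))
    (hpin : ∀ x x' : Fin n → Bool, (∀ j ∈ J₀, I.eval x j = y j) → gval I w₂.1 w₂.2.1 x = w₂.2.2 →
      (∀ j ∈ J₀, I.eval x' j = y j) → gval I w₂.1 w₂.2.1 x' = w₂.2.2 → gval I φ.1 φ.2.1 x = gval I φ.1 φ.2.1 x')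
    {x : Fin n → Bool} (hx : ∀ j ∈ J₀, I.eval x j = y j) (hxw : gval I w₂.1 w₂.2.1 x = w₂.2.2)
    (h0 : (x (I.vars c 2) && x (I.vars c 3)) = false) (h0' : (x (I.vars c' 2) && x (I.vars c' 3)) = false) :
    (φ.1 ∩ {I.vars c 2, I.vars c 3} = ∅ ∨ φ.1 ∩ {I.vars c 2, I.vars c 3} = w₂.1 ∩ {I.vars c 2, I.vars c 3}) ∧
    (φ.1 ∩ {I.vars c' 2, I.vars c' 3} = ∅ ∨ φ.1 ∩ {I.vars c' 2, I.vars c' 3} = w₂.1 ∩ {I.vars c' 2, I.vars c' 3}) ∧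
    (φ.1 ∩ {I.vars c 2, I.vars c 3} = ∅ ↔ φ.1 ∩ {I.vars c' 2, I.vars c' 3} = ∅) := by
  classical
  have zaa : ∀ t : ZMod 2, t + t = 0 := by decide
  -- the four privates are pairwise distinct
  have hab : I.vars c 2 ≠ I.vars c 3 := fun h => absurd (hI.2 c h) (by decide)
  have cross : ∀ s : Fin 4, I.vars c' s ≠ I.vars c 2 ∧ I.vars c' s ≠ I.vars c 3 := by
    intro s
    constructor
    · intro h
      exact not_mem_varSet_of_private I hc hc' hne.symm hch.1 (vars_mem_varSet I c 2) (h ▸ vars_mem_varSet I c' s)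
    · intro h
      exact not_mem_varSet_of_private I hc hc' hne.symm hch.2 (vars_mem_varSet I c 3) (h ▸ vars_mem_varSet I c' s)
  -- the nine points
  set X : Bool → Bool → (Fin n → Bool) := fun s₁ s₂ => Function.update (Function.update x (I.vars c 2) s₁) (I.vars c 3) s₂ with hX
  set P : Bool → Bool → Bool → Bool → (Fin n → Bool) :=
    fun s₁ s₂ s₁' s₂' => Function.update (Function.update (X s₁ s₂) (I.vars c' 2) s₁') (I.vars c' 3) s₂' with hP
  have hXa' : ∀ s₁ s₂, X s₁ s₂ (I.vars c' 2) = x (I.vars c' 2) := fun s₁ s₂ => setPair_of_ne I c x s₁ s₂ (cross 2).1 (cross 2).2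
  have hXb' : ∀ s₁ s₂, X s₁ s₂ (I.vars c' 3) = x (I.vars c' 3) := fun s₁ s₂ => setPair_of_ne I c x s₁ s₂ (cross 3).1 (cross 3).2
  -- they solve `J₀`
  have hsolX : ∀ s₁ s₂, (s₁ && s₂) = false → ∀ j ∈ J₀, I.eval (X s₁ s₂) j = y j := by
    intro s₁ s₂ hs j hj
    by_cases hjc : j = c
    · subst hjc
      rw [hX, eval_setPair_self I hI j x (a' := x (I.vars j 2)) (b' := x (I.vars j 3)) (by rw [hs, h0]), Function.update_eq_self,
        Function.update_eq_self]
      exact hx j hj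
    · rw [hX, eval_setPair_of_ne I hc hch x s₁ s₂ hj hjc]
      exact hx j hj
  have hsol : ∀ s₁ s₂ s₁' s₂', (s₁ && s₂) = false → (s₁' && s₂') = false → ∀ j ∈ J₀, I.eval (P s₁ s₂ s₁' s₂') j = y j := by
    intro s₁ s₂ s₁' s₂' hs hs' j hj
    by_cases hjc : j = c'
    · subst hjc
      rw [hP]
      dsimp only
      rw [eval_setPair_self I hI j (X s₁ s₂) (a' := X s₁ s₂ (I.vars j 2)) (b' := X s₁ s₂ (I.vars j 3)) (by rw [hs', hXa', hXb', h0']),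
        Function.update_eq_self, Function.update_eq_self]
      exact hsolX s₁ s₂ hs j hj
    · rw [hP]
      dsimp only
      rw [eval_setPair_of_ne I hc' hch' (X s₁ s₂) s₁' s₂' hj hjc]
      exact hsolX s₁ s₂ hs j hj
  -- the value of a gate-free constraint at the nine points
  have hval : ∀ A : Finset (Fin n) × Finset (Fin m) × Bool,
      (∀ g ∈ A.2.1, I.vars g 2 ≠ I.vars c 2 ∧ I.vars g 3 ≠ I.vars c 2 ∧ I.vars g 2 ≠ I.vars c 3 ∧ I.vars g 3 ≠ I.vars c 3) →
      (∀ g ∈ A.2.1, I.vars g 2 ≠ I.vars c' 2 ∧ I.vars g 3 ≠ I.vars c' 2 ∧ I.vars g 2 ≠ I.vars c' 3 ∧ I.vars g 3 ≠ I.vars c' 3) →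
      ∀ s₁ s₂ s₁' s₂', bit (gval I A.1 A.2.1 (P s₁ s₂ s₁' s₂')) = bit (gval I A.1 A.2.1 x)
        + ((if I.vars c 2 ∈ A.1 then (1 : ZMod 2) else 0) * (bit s₁ + bit (x (I.vars c 2)))
          + (if I.vars c 3 ∈ A.1 then (1 : ZMod 2) else 0) * (bit s₂ + bit (x (I.vars c 3))))
        + ((if I.vars c' 2 ∈ A.1 then (1 : ZMod 2) else 0) * (bit s₁' + bit (x (I.vars c' 2)))
          + (if I.vars c' 3 ∈ A.1 then (1 : ZMod 2) else 0) * (bit s₂' + bit (x (I.vars c' 3)))) := by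
    intro A hA hA' s₁ s₂ s₁' s₂'
    rw [hP]
    dsimp only
    rw [bit_gval_setPair I hI hA' (X s₁ s₂) s₁' s₂', hXa', hXb', hX, bit_gval_setPair I hI hA x s₁ s₂,
      ite_eq_ind_mul (I.vars c 2 ∈ A.1), ite_eq_ind_mul (I.vars c 3 ∈ A.1), ite_eq_ind_mul (I.vars c' 2 ∈ A.1), ite_eq_ind_mul (I.vars c' 3 ∈ A.1)]
    ring
  -- coefficients
  set α : ZMod 2 := if I.vars c 2 ∈ w₂.1 then 1 else 0 with hα
  set β : ZMod 2 := if I.vars c 3 ∈ w₂.1 then 1 else 0 with hβ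
  set α' : ZMod 2 := if I.vars c' 2 ∈ w₂.1 then 1 else 0 with hα'
  set β' : ZMod 2 := if I.vars c' 3 ∈ w₂.1 then 1 else 0 with hβ'
  set p : ZMod 2 := if I.vars c 2 ∈ φ.1 then 1 else 0 with hp
  set q : ZMod 2 := if I.vars c 3 ∈ φ.1 then 1 else 0 with hq
  set p' : ZMod 2 := if I.vars c' 2 ∈ φ.1 then 1 else 0 with hp'
  set q' : ZMod 2 := if I.vars c' 3 ∈ φ.1 then 1 else 0 with hq'
  set xa := x (I.vars c 2) with hxa
  set xb := x (I.vars c 3) with hxb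
  set xa' := x (I.vars c' 2) with hxa'
  set xb' := x (I.vars c' 3) with hxb'
  -- pinning at the nine points
  have H : ∀ s₁ s₂ s₁' s₂', (s₁ && s₂) = false → (s₁' && s₂') = false →
      α * (bit s₁ + bit xa) + β * (bit s₂ + bit xb) + (α' * (bit s₁' + bit xa') + β' * (bit s₂' + bit xb')) = 0 →
      p * (bit s₁ + bit xa) + q * (bit s₂ + bit xb) + (p' * (bit s₁' + bit xa') + q' * (bit s₂' + bit xb')) = 0 := by
    intro s₁ s₂ s₁' s₂' hs hs' hδ
    have hZ : gval I w₂.1 w₂.2.1 (P s₁ s₂ s₁' s₂') = w₂.2.2 := by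
      apply bit_injective
      rw [hval w₂ hg.1 hg.2, add_assoc, hδ, add_zero, hxw]
    have hφx := hpin _ _ (hsol s₁ s₂ s₁' s₂' hs hs') hZ hx hxw
    have hv := hval φ hφ.1 hφ.2 s₁ s₂ s₁' s₂'
    rw [hφx, add_assoc] at hv
    have e : ∀ g t : ZMod 2, g = g + t → t = 0 := by decide
    exact e _ _ hv
  have hread : α ≠ 0 ∨ β ≠ 0 := by
    rcases hw.1 with h | h
    · left; rw [hα, if_pos h]; exact one_ne_zero
    · right; rw [hβ, if_pos h]; exact one_ne_zero
  have hread' : α' ≠ 0 ∨ β' ≠ 0 := by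
    rcases hw.2 with h | h
    · left; rw [hα', if_pos h]; exact one_ne_zero
    · right; rw [hβ', if_pos h]; exact one_ne_zero
  -- a move of `c'` seen by `w₂`, and the common sign `ε`
  obtain ⟨u₁, u₂, hu, hfu⟩ := exists_move xa' xb' h0' α' β' hread'
  set ε : ZMod 2 := p' * (bit u₁ + bit xa') + q' * (bit u₂ + bit xb') with hε
  have hcε : p = ε * α ∧ q = ε * β := by
    refine align_core xa xb h0 α β p q ε fun s₁ s₂ hs => ⟨fun hf => ?_, fun hf => ?_⟩
    · have h := H s₁ s₂ xa' xb' hs h0' (by rw [hf, zaa, zaa, mul_zero, mul_zero, add_zero, zero_add])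
      rw [zaa, zaa, mul_zero, mul_zero, add_zero, add_zero] at h
      exact h
    · have h := H s₁ s₂ u₁ u₂ hs hu (by rw [hf, hfu]; decide)
      have e : ∀ g t : ZMod 2, g + t = 0 → g = t := by decide
      exact e _ _ h
  -- symmetrically for `c'`, with the same `ε`
  obtain ⟨v₁, v₂, hv, hfv⟩ := exists_move xa xb h0 α β hread
  have hgv : p * (bit v₁ + bit xa) + q * (bit v₂ + bit xb) = ε := by
    rw [hcε.1, hcε.2, mul_assoc, mul_assoc, ← mul_add, hfv, mul_one]
  have hcε' : p' = ε * α' ∧ q' = ε * β' := by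
    refine align_core xa' xb' h0' α' β' p' q' ε fun s₁' s₂' hs' => ⟨fun hf => ?_, fun hf => ?_⟩
    · have h := H xa xb s₁' s₂' h0 hs' (by rw [hf, zaa, zaa, mul_zero, mul_zero, add_zero, zero_add])
      rw [zaa, zaa, mul_zero, mul_zero, add_zero, zero_add] at h
      exact h
    · have h := H v₁ v₂ s₁' s₂' hv hs' (by rw [hf, hfv]; decide)
      rw [hgv] at h
      have e : ∀ g t : ZMod 2, g + t = 0 → t = g := by decide
      exact e _ _ h
  -- reading off the memberships
  have ind_iff : ∀ (P Q : Prop) [Decidable P] [Decidable Q], ((if P then (1 : ZMod 2) else 0) = if Q then 1 else 0) → (P ↔ Q) := by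
    intro P Q _ _ h
    by_cases hP : P <;> by_cases hQ : Q <;> simp only [hP, hQ, if_true, if_false] at h ⊢
    · exact (one_ne_zero h).elim
    · exact (zero_ne_one h).elim
  have pair_eq : ∀ {S T : Finset (Fin n)} {u v : Fin n}, (u ∈ S ↔ u ∈ T) → (v ∈ S ↔ v ∈ T) → S ∩ {u, v} = T ∩ {u, v} := by
    intro S T u v hu hv
    ext w
    simp only [mem_inter, mem_insert, mem_singleton]
    constructor
    · rintro ⟨hw, h | h⟩
      · subst h; exact ⟨hu.1 hw, Or.inl rfl⟩
      · subst h; exact ⟨hv.1 hw, Or.inr rfl⟩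
    · rintro ⟨hw, h | h⟩
      · subst h; exact ⟨hu.2 hw, Or.inl rfl⟩
      · subst h; exact ⟨hv.2 hw, Or.inr rfl⟩
  have pair_empty : ∀ {S : Finset (Fin n)} {u v : Fin n}, S ∩ {u, v} = ∅ ↔ (u ∉ S ∧ v ∉ S) := by
    intro S u v
    rw [eq_empty_iff_forall_notMem]
    constructor
    · intro h
      exact ⟨fun hu => h u (mem_inter.2 ⟨hu, mem_insert_self _ _⟩), fun hv => h v (mem_inter.2 ⟨hv, mem_insert_of_mem (mem_singleton_self _)⟩)⟩
    · rintro ⟨hu, hv⟩ w hw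
      rw [mem_inter, mem_insert, mem_singleton] at hw
      rcases hw.2 with h | h
      · exact hu (h ▸ hw.1)
      · exact hv (h ▸ hw.1)
  rcases (by decide : ∀ e : ZMod 2, e = 0 ∨ e = 1) ε with hε0 | hε1
  · -- `φ` reads neither chord
    rw [hε0, zero_mul, zero_mul] at hcε hcε'
    have ha : I.vars c 2 ∉ φ.1 := fun h => by rw [hp, if_pos h] at hcε; exact one_ne_zero hcε.1
    have hb : I.vars c 3 ∉ φ.1 := fun h => by rw [hq, if_pos h] at hcε; exact one_ne_zero hcε.2
    have ha' : I.vars c' 2 ∉ φ.1 := fun h => by rw [hp', if_pos h] at hcε'; exact one_ne_zero hcε'.1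
    have hb' : I.vars c' 3 ∉ φ.1 := fun h => by rw [hq', if_pos h] at hcε'; exact one_ne_zero hcε'.2
    exact ⟨Or.inl (pair_empty.2 ⟨ha, hb⟩), Or.inl (pair_empty.2 ⟨ha', hb'⟩), ⟨fun _ => pair_empty.2 ⟨ha', hb'⟩, fun _ => pair_empty.2 ⟨ha, hb⟩⟩⟩
  · -- `φ` reads both chords exactly as `w₂` does
    rw [hε1, one_mul, one_mul] at hcε hcε'
    have e1 := pair_eq (ind_iff _ _ hcε.1) (ind_iff _ _ hcε.2)
    have e2 := pair_eq (ind_iff _ _ hcε'.1) (ind_iff _ _ hcε'.2)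
    refine ⟨Or.inr e1, Or.inr e2, ?_⟩
    rw [e1, e2, pair_empty, pair_empty]
    constructor
    · rintro ⟨h2, h3⟩
      exact (hw.1.elim h2 h3).elim
    · rintro ⟨h2, h3⟩
      exact (hw.2.elim h2 h3).elim

end Summit.PneNP.PneNP.Theorems.PstarUnionCaseB
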